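import Summits.QuantumFields.YangMills.Theorems.FluctuationComparisonRegPrIntLS2BetaConeOnSquare
import Summits.QuantumFields.YangMills.Theorems.FluctuationComparisonRegPrIntLS2BetaSquareRingModulus
import Summits.QuantumFields.YangMills.Theorems.FluctuationComparisonRegPrIntLS2BetaBlockOffsetCoordinates
import HarnessLib

/-!
# S2β · D-GUARD ∕ (BG∞) — STAGE T ON A BLOCK ((L-T) of UV3-NODE §116 ADDENDUM 1, binder style per desk RULING №127): the cone on a discrete square
# ✓p839841 (T2) with its ring modulus ✓p839846 (T0), read through the OFFSET COORDINATES of a closed block (✓p839889), is a section of the block with the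
# prescribed data on the ring of every `(α, β)`-slice, in-slice steps `≤ 6Λη + 3(π−r)∕n`, across-slice steps `≤ Λμ`, and the cap position — the stage of
# classes 110 ∕ 101 ∕ 011 of the 8-colour gluing (mirror of px19 g25's (L-I) «STAGE I ON A BLOCK»)

Cell `ym3-torus` (YM ladder rung R3 = continuum `SU(2)` Yang–Mills on the three-torus at fixed lattice data — a RUNG: NOT d = 4, NOT infinite volume,
NOT a mass gap, NOT Clay).  Width seat «width 5» `ym3-torus-px5` (gen 24), FREE px helper on crux `stmt-QuantumFields-20520` (`FluctuationComparisonRegPrIntL`;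
registry `Lines/semiclassical_s2beta.lean` UNTOUCHED, 0∕5); `--kind proof --supports stmt-QuantumFields-20520 --as helper`, count-neutral, DEFINITION-FREE
(0 `def`, 0 `instance`, 0 `notation`, 0 `sorry`, default heartbeats).  The square operator `Wsq` enters as a BINDER whose law `hWsq` is the body of
✓`exists_coneOnSquare n … a` VERBATIM (the assembler does `obtain ⟨Wsq, hWsq⟩ := exists_coneOnSquare n hn hr hrπ a` once per block), and the block section `W` is
PINNED by the displayed hypothesis `hW : ∀ t, W t = Wsq (slice datum of t) (t α, t β)`.

WHY.  In the descent formulation (UV3-NODE §116 ADD.1) a stage-2 block `Q` (two long axes `α ≠ β`, side `n`) carries, on every `(α, β)`-slice (the other offsets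
fixed), the cone filling of the slice's ring data: `W t := Wsq ψ_t (t α, t β)` with the SLICE DATUM `ψ_t (i, k) := φ (t|_{α↦i, β↦k})`.  A bond inside the block is
ONE unit step of ONE offset (✓`read_tgt_eq`): an `α`- or `β`-step keeps `ψ_t` and moves `(t α, t β)` (§1), so T2 (iii) — fed the `ℓ¹`-modulus `2η` that T0
derives from PER-BOND ring oscillation `η` — IS the in-slice bond bound; a step in a third direction `γ` changes the slice, and T2 (iv) IS the across-slice bound
with `μ` := the data's oscillation along the `γ`-bonds through the ring; T2 (i) IS the ring agreement ((DESC₁) of ADD.1) and T2 (ii) the cap position.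

WHAT IS PROVED (sorry-free; `Λ := (π − r)∕sin r`; «ring» of a slice = `i ≤ n ∧ k ≤ n ∧ (i = 0 ∨ i = n ∨ k = 0 ∨ k = n)` for `(i, k) = (u α, u β)`;
«`u` in the slice of `t`» = `update (update u α (t α)) β (t β) = t`; all hypotheses are SLICE-LOCAL — nothing is asked of `φ` off the bond's own slice(s)).
* §1 offset algebra of slices and steps (`update` only): `uu_apply_fst∕snd∕of_ne`, `uu_mem_slice`, `uu_step_fst∕snd∕of_ne`, `slice_step_fst∕snd`, `ringAdj_of_steps`
  (per-bond ring steps ⟹ T0's symmetric adjacency form).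
* §2 OFFSET-LEVEL LAWS for any offset vector `t` with `t α, t β ≤ n`: ★ `stageT_ring_eq` (`W t = φ t` on the ring), ★★ `norm_logVec_inv_stageT_le` (`‖logVec (a⁻¹·W t)‖ ≤ π − r`),
  ★★★ `dist1_stageT_step_fst_le` ∕ `dist1_stageT_step_snd_le` (`dist1 (W t·(W (update t α (t α+1)))⁻¹) ≤ 6Λη + 3(π−r)∕n` from ring cap + per-bond ring oscillation `η`
  of the slice), ★★★ `dist1_stageT_step_of_ne_le` (`γ ∉ {α, β}`: `dist1 (W t·(W (update t γ (t γ+1)))⁻¹) ≤ Λ·μ` from the two rings' caps and the ring-pointwise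
  `γ`-bond oscillation `μ`).
* §3 BOND-LEVEL LAWS (sites `x : Site P j`, bonds `b : PBond P j`, offsets `t(x) κ := (x κ − (s κ : ZMod N)).val`, no-wrap `hN` as in (L-I)):
  ★★★ `dist1_stageT_inslice_le` (`b.dir = α ∨ b.dir = β`), ★★★ `dist1_stageT_transverse_le` (`b.dir ≠ α`, `b.dir ≠ β`) — by `rw [read_tgt_eq]` onto §2.

HONEST SCOPE.  Composition of landed sphere∕lattice geometry (✓p839841, ✓p839846) with offset bookkeeping (✓p839889); no gauge field; nothing of Bałaban's
renormalisation-group analysis is asserted or proved ([Balaban1985RegularSpaces] Lemma 1 p.79, (1.36) p.82, Thm 2 p.83 — local small gauges).  (BG∞) ∕ `hsupp⁺`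
is a CONJECTURE (plan §116) and is NOT proved; (L-S)(L-Σ) and the assembly `hBG_of_pieces` are OPEN; GAP♯∘ (`stub_uniformFibreGapOrbit`, registry UNTOUCHED), the
five registered stubs (0∕5), S2β, 20520, 19936, 19200, `YM3TorusSU2` are NOT proved; no registered stub is closed; rung R3 — NOT d = 4, NOT infinite volume,
NOT a mass gap, NOT Clay; the Yang–Mills mass gap is NOT proved.  Axioms standard.

References: T. Bałaban, CMP **99** (1985) 75–102 [Balaban1985RegularSpaces] (Lemma 1 p.79, (1.36) p.82, Thm 2 p.83).
-/

set_option autoImplicit false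

noncomputable section

namespace Summit.QuantumFields.YangMills.Theorems.FluctuationComparisonRegPrIntLS2BetaSqrtGaugeStageTBlock

open scoped Real
open Literature.MathematicalPhysics.QuantumLattice (su2Quat)
open Literature.MathematicalPhysics.QuantumFieldTheory.Balaban1983to89
open T4CubeChartGnomonic (SU2)
open T4HaarSU2ExpChart (expPoint)
open T4ExpWindowSmallField (logVec)
open Summit.QuantumFields.YangMills.Theorems.FluctuationComparisonRegPrIntLS2BetaSquareRingModulus (dist1_boundary_le_two_mul_l1)
open Summit.QuantumFields.YangMills.Theorems.FluctuationComparisonRegPrIntLS2BetaBlockOffsetCoordinates (read_tgt_eq)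

variable {P : Params} {j : ℕ}

/-! ## §1 Offset algebra of slices and steps -/

/-- The slice point `t|_{α↦i, β↦k}` has `α`-offset `i` (`α ≠ β`). [folklore] -/
theorem uu_apply_fst {d : ℕ} (t : Fin d → ℕ) {α β : Fin d} (hαβ : α ≠ β) (i k : ℕ) :
    Function.update (Function.update t α i) β k α = i := by
  rw [Function.update_of_ne hαβ, Function.update_self]

/-- The slice point `t|_{α↦i, β↦k}` has `β`-offset `k`. [folklore] -/
theorem uu_apply_snd {d : ℕ} (t : Fin d → ℕ) (α β : Fin d) (i k : ℕ) :
    Function.update (Function.update t α i) β k β = k := Function.update_self ..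

/-- The slice point `t|_{α↦i, β↦k}` agrees with `t` off `{α, β}`. [folklore] -/
theorem uu_apply_of_ne {d : ℕ} (t : Fin d → ℕ) {α β κ : Fin d} (hκα : κ ≠ α) (hκβ : κ ≠ β) (i k : ℕ) :
    Function.update (Function.update t α i) β k κ = t κ := by
  rw [Function.update_of_ne hκβ, Function.update_of_ne hκα]

/-- The slice point `t|_{α↦i, β↦k}` lies in the slice of `t`. [folklore] -/
theorem uu_mem_slice {d : ℕ} (t : Fin d → ℕ) {α β : Fin d} (hαβ : α ≠ β) (i k : ℕ) :
    Function.update (Function.update (Function.update (Function.update t α i) β k) α (t α)) β (t β) = t := by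
  rw [Function.update_comm (Ne.symm hαβ) k (t α) (Function.update t α i)]
  simp only [Function.update_idem, Function.update_eq_self]

/-- An `α`-step from the slice point `t|_{α↦i, β↦k}` is the slice point `t|_{α↦i+1, β↦k}`. [folklore] -/
theorem uu_step_fst {d : ℕ} (t : Fin d → ℕ) {α β : Fin d} (hαβ : α ≠ β) (i k : ℕ) :
    Function.update (Function.update (Function.update t α i) β k) α (Function.update (Function.update t α i) β k α + 1) =
      Function.update (Function.update t α (i + 1)) β k := by
  rw [uu_apply_fst t hαβ, Function.update_comm (Ne.symm hαβ) k (i + 1) (Function.update t α i), Function.update_idem]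

/-- A `β`-step from the slice point `t|_{α↦i, β↦k}` is the slice point `t|_{α↦i, β↦k+1}`. [folklore] -/
theorem uu_step_snd {d : ℕ} (t : Fin d → ℕ) (α β : Fin d) (i k : ℕ) :
    Function.update (Function.update (Function.update t α i) β k) β (Function.update (Function.update t α i) β k β + 1) =
      Function.update (Function.update t α i) β (k + 1) := by
  rw [uu_apply_snd, Function.update_idem]

/-- A `γ`-step (`γ ∉ {α, β}`) from the slice point `t|_{α↦i, β↦k}` is the slice point of the stepped `t`. [folklore] -/
theorem uu_step_of_ne {d : ℕ} (t : Fin d → ℕ) {α β γ : Fin d} (hγα : γ ≠ α) (hγβ : γ ≠ β) (i k v : ℕ) :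
    Function.update (Function.update (Function.update t α i) β k) γ v =
      Function.update (Function.update (Function.update t γ v) α i) β k := by
  rw [Function.update_comm (Ne.symm hγβ) k v (Function.update t α i), Function.update_comm (Ne.symm hγα) i v t]

/-- An `α`-step of `t` keeps the slice datum. [folklore] -/
theorem slice_step_fst {d : ℕ} {G : Type*} (φ : (Fin d → ℕ) → G) (t : Fin d → ℕ) (α β : Fin d) (v : ℕ) :
    (fun p : ℕ × ℕ => φ (Function.update (Function.update (Function.update t α v) α p.1) β p.2)) =
      fun p : ℕ × ℕ => φ (Function.update (Function.update t α p.1) β p.2) := by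
  funext p
  rw [Function.update_idem]

/-- A `β`-step of `t` keeps the slice datum (`α ≠ β`). [folklore] -/
theorem slice_step_snd {d : ℕ} {G : Type*} (φ : (Fin d → ℕ) → G) (t : Fin d → ℕ) {α β : Fin d} (hαβ : α ≠ β) (v : ℕ) :
    (fun p : ℕ × ℕ => φ (Function.update (Function.update (Function.update t β v) α p.1) β p.2)) =
      fun p : ℕ × ℕ => φ (Function.update (Function.update t α p.1) β p.2) := by
  funext p
  rw [Function.update_comm (Ne.symm hαβ) v p.1 t, Function.update_idem]

/-- **Per-bond ring steps give T0's symmetric adjacency form**: bounds on the `(i,k) → (i+1,k)` and `(i,k) → (i,k+1)` ring steps of a square datum `ψ` give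
`dist1 (ψ P·(ψ Q)⁻¹) ≤ η` for every pair of ring points at `ℓ¹`-distance `1`. [folklore] -/
theorem ringAdj_of_steps {G : Type*} [GaugeGroup G] (n : ℕ) (ψ : ℕ × ℕ → G) {η : ℝ}
    (hH : ∀ i k, i + 1 ≤ n → k ≤ n → (i = 0 ∨ i = n ∨ k = 0 ∨ k = n) → (i + 1 = n ∨ k = 0 ∨ k = n) →
      dist1 (ψ (i, k) * (ψ (i + 1, k))⁻¹) ≤ η)
    (hV : ∀ i k, i ≤ n → k + 1 ≤ n → (i = 0 ∨ i = n ∨ k = 0 ∨ k = n) → (i = 0 ∨ i = n ∨ k + 1 = n) →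
      dist1 (ψ (i, k) * (ψ (i, k + 1))⁻¹) ≤ η) :
    ∀ P Q : ℕ × ℕ, P.1 ≤ n → P.2 ≤ n → (P.1 = 0 ∨ P.1 = n ∨ P.2 = 0 ∨ P.2 = n) →
      Q.1 ≤ n → Q.2 ≤ n → (Q.1 = 0 ∨ Q.1 = n ∨ Q.2 = 0 ∨ Q.2 = n) →
      Nat.dist P.1 Q.1 + Nat.dist P.2 Q.2 = 1 → dist1 (ψ P * (ψ Q)⁻¹) ≤ η := by
  rintro ⟨p1, p2⟩ ⟨q1, q2⟩ hp1 hp2 hpb hq1 hq2 hqb hd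
  simp only at hp1 hp2 hpb hq1 hq2 hqb hd ⊢
  unfold Nat.dist at hd
  rcases (show (q1 = p1 + 1 ∧ q2 = p2) ∨ (p1 = q1 + 1 ∧ p2 = q2) ∨ (q1 = p1 ∧ q2 = p2 + 1) ∨ (q1 = p1 ∧ p2 = q2 + 1) by omega) with
    ⟨h1, h2⟩ | ⟨h1, h2⟩ | ⟨h1, h2⟩ | ⟨h1, h2⟩
  · rw [h1, h2]
    exact hH p1 p2 (by omega) hp2 hpb (by omega)
  · rw [h1, h2, ← GaugeGroup.dist1_inv, mul_inv_rev, inv_inv]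
    exact hH q1 q2 (by omega) hq2 hqb (by omega)
  · rw [h1, h2]
    exact hV p1 p2 hp1 (by omega) hpb (by omega)
  · rw [h1, h2, ← GaugeGroup.dist1_inv, mul_inv_rev, inv_inv]
    exact hV p1 q2 hp1 (by omega) (by omega) (by omega)

section StageT

variable (φ : (Fin P.d → ℕ) → SU2) (a : SU2) (α β : Fin P.d) (n : ℕ) (r : ℝ)
  (Wsq : (ℕ × ℕ → SU2) → (ℕ × ℕ → SU2))
  (hWsq : ∀ ψ : ℕ × ℕ → SU2,
      (∀ i k, i ≤ n → k ≤ n → (i = 0 ∨ i = n ∨ k = 0 ∨ k = n) → ‖logVec (su2Quat (a⁻¹ * ψ (i, k)))‖ ≤ π - r) →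
      (∀ i k, i ≤ n → k ≤ n → (i = 0 ∨ i = n ∨ k = 0 ∨ k = n) → Wsq ψ (i, k) = ψ (i, k)) ∧
      (∀ i k, i ≤ n → k ≤ n → ‖logVec (su2Quat (a⁻¹ * Wsq ψ (i, k)))‖ ≤ π - r) ∧
      (∀ lam : ℝ, 0 ≤ lam →
        (∀ p q : ℕ × ℕ, p.1 ≤ n → p.2 ≤ n → (p.1 = 0 ∨ p.1 = n ∨ p.2 = 0 ∨ p.2 = n) →
          q.1 ≤ n → q.2 ≤ n → (q.1 = 0 ∨ q.1 = n ∨ q.2 = 0 ∨ q.2 = n) →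
          dist1 (ψ p * (ψ q)⁻¹) ≤ lam * ((Nat.dist p.1 q.1 + Nat.dist p.2 q.2 : ℕ) : ℝ)) →
        (∀ i k, i + 1 ≤ n → k ≤ n → dist1 (Wsq ψ (i, k) * (Wsq ψ (i + 1, k))⁻¹) ≤ 3 * ((π - r) / Real.sin r) * lam + 3 * (π - r) / n) ∧
        (∀ i k, i ≤ n → k + 1 ≤ n → dist1 (Wsq ψ (i, k) * (Wsq ψ (i, k + 1))⁻¹) ≤ 3 * ((π - r) / Real.sin r) * lam + 3 * (π - r) / n)) ∧
      (∀ ψ' : ℕ × ℕ → SU2, ∀ μ : ℝ,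
        (∀ i k, i ≤ n → k ≤ n → (i = 0 ∨ i = n ∨ k = 0 ∨ k = n) → ‖logVec (su2Quat (a⁻¹ * ψ' (i, k)))‖ ≤ π - r) →
        (∀ i k, i ≤ n → k ≤ n → (i = 0 ∨ i = n ∨ k = 0 ∨ k = n) → dist1 (ψ (i, k) * (ψ' (i, k))⁻¹) ≤ μ) →
        ∀ i k, i ≤ n → k ≤ n → dist1 (Wsq ψ (i, k) * (Wsq ψ' (i, k))⁻¹) ≤ ((π - r) / Real.sin r) * μ))
  (W : (Fin P.d → ℕ) → SU2)
  (hW : ∀ t : Fin P.d → ℕ, W t = Wsq (fun p => φ (Function.update (Function.update t α p.1) β p.2)) (t α, t β))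

/-! ## §2 Offset-level laws -/

/-- The ring cap of the slice of `t`, read as the cap hypothesis of T2 for the slice datum `ψ_t`. [folklore] -/
theorem sliceCap_of_ringCap (hαβ : α ≠ β) (t : Fin P.d → ℕ)
    (hcap : ∀ u : Fin P.d → ℕ, Function.update (Function.update u α (t α)) β (t β) = t → u α ≤ n → u β ≤ n →
      (u α = 0 ∨ u α = n ∨ u β = 0 ∨ u β = n) → ‖logVec (su2Quat (a⁻¹ * φ u))‖ ≤ π - r) :
    ∀ i k, i ≤ n → k ≤ n → (i = 0 ∨ i = n ∨ k = 0 ∨ k = n) →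
      ‖logVec (su2Quat (a⁻¹ * (fun p : ℕ × ℕ => φ (Function.update (Function.update t α p.1) β p.2)) (i, k)))‖ ≤ π - r := by
  intro i k hi hk hb
  have h := hcap (Function.update (Function.update t α i) β k) (uu_mem_slice t hαβ i k)
  rw [uu_apply_fst t hαβ, uu_apply_snd] at h
  exact h hi hk hb

include hW hWsq in
/-- ★ **THE RING AGREEMENT** ((DESC₁) of ADD.1): on the ring of its slice (`t α, t β ≤ n`, one of them `∈ {0, n}`), with the slice's ring data inside the cap of `a`,
the section is the datum: `W t = φ t` (T2 (i)). [folklore] -/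
theorem stageT_ring_eq (hαβ : α ≠ β) (t : Fin P.d → ℕ) (hα : t α ≤ n) (hβ : t β ≤ n) (hring : t α = 0 ∨ t α = n ∨ t β = 0 ∨ t β = n)
    (hcap : ∀ u : Fin P.d → ℕ, Function.update (Function.update u α (t α)) β (t β) = t → u α ≤ n → u β ≤ n →
      (u α = 0 ∨ u α = n ∨ u β = 0 ∨ u β = n) → ‖logVec (su2Quat (a⁻¹ * φ u))‖ ≤ π - r) :
    W t = φ t := by
  rw [hW t, (hWsq (fun p => φ (Function.update (Function.update t α p.1) β p.2))
    (sliceCap_of_ringCap φ a α β n r hαβ t hcap)).1 (t α) (t β) hα hβ hring]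
  simp only [Function.update_eq_self]

include hW hWsq in
/-- ★★ **THE CAP POSITION**: everywhere on the square of its slice (`t α, t β ≤ n`), with the slice's ring data inside the cap of `a`, the section stays inside the cap:
`‖logVec (a⁻¹·W t)‖ ≤ π − r` (T2 (ii)). [folklore] -/
theorem norm_logVec_inv_stageT_le (hαβ : α ≠ β) (t : Fin P.d → ℕ) (hα : t α ≤ n) (hβ : t β ≤ n)
    (hcap : ∀ u : Fin P.d → ℕ, Function.update (Function.update u α (t α)) β (t β) = t → u α ≤ n → u β ≤ n →
      (u α = 0 ∨ u α = n ∨ u β = 0 ∨ u β = n) → ‖logVec (su2Quat (a⁻¹ * φ u))‖ ≤ π - r) :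
    ‖logVec (su2Quat (a⁻¹ * W t))‖ ≤ π - r := by
  rw [hW t]
  exact (hWsq (fun p => φ (Function.update (Function.update t α p.1) β p.2))
    (sliceCap_of_ringCap φ a α β n r hαβ t hcap)).2.1 (t α) (t β) hα hβ

/-- The per-bond ring oscillation of the slice of `t`, read as T2 (iii)'s `ℓ¹`-modulus `2η` for the slice datum (via T0 ✓`dist1_boundary_le_two_mul_l1`). [folklore] -/
theorem sliceModulus_of_ringSteps (hαβ : α ≠ β) (t : Fin P.d → ℕ) {η : ℝ} (hη : 0 ≤ η)
    (hstep : ∀ u : Fin P.d → ℕ, ∀ κ : Fin P.d, (κ = α ∨ κ = β) → Function.update (Function.update u α (t α)) β (t β) = t →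
      u α ≤ n → u β ≤ n → (u α = 0 ∨ u α = n ∨ u β = 0 ∨ u β = n) →
      Function.update u κ (u κ + 1) α ≤ n → Function.update u κ (u κ + 1) β ≤ n →
      (Function.update u κ (u κ + 1) α = 0 ∨ Function.update u κ (u κ + 1) α = n ∨
        Function.update u κ (u κ + 1) β = 0 ∨ Function.update u κ (u κ + 1) β = n) →
      dist1 (φ u * (φ (Function.update u κ (u κ + 1)))⁻¹) ≤ η) :
    ∀ p q : ℕ × ℕ, p.1 ≤ n → p.2 ≤ n → (p.1 = 0 ∨ p.1 = n ∨ p.2 = 0 ∨ p.2 = n) →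
      q.1 ≤ n → q.2 ≤ n → (q.1 = 0 ∨ q.1 = n ∨ q.2 = 0 ∨ q.2 = n) →
      dist1 ((fun p : ℕ × ℕ => φ (Function.update (Function.update t α p.1) β p.2)) p *
        ((fun p : ℕ × ℕ => φ (Function.update (Function.update t α p.1) β p.2)) q)⁻¹) ≤
        2 * η * ((Nat.dist p.1 q.1 + Nat.dist p.2 q.2 : ℕ) : ℝ) := by
  refine dist1_boundary_le_two_mul_l1 n _ hη (ringAdj_of_steps n _ (fun i k hi hk hb hb' => ?_) (fun i k hi hk hb hb' => ?_))
  · -- the `α`-step `(i,k) → (i+1,k)`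
    have h := hstep (Function.update (Function.update t α i) β k) α (Or.inl rfl) (uu_mem_slice t hαβ i k)
    rw [uu_step_fst t hαβ, uu_apply_fst t hαβ, uu_apply_snd, uu_apply_fst t hαβ, uu_apply_snd] at h
    exact h (by omega) hk hb hi hk (by omega)
  · -- the `β`-step `(i,k) → (i,k+1)`
    have h := hstep (Function.update (Function.update t α i) β k) β (Or.inr rfl) (uu_mem_slice t hαβ i k)
    rw [uu_step_snd t α β, uu_apply_fst t hαβ, uu_apply_snd, uu_apply_fst t hαβ, uu_apply_snd] at h
    exact h hi (by omega) hb hi hk (by omega)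

include hW hWsq in
/-- ★★★ **THE IN-SLICE `α`-STEP**: for an offset vector `t` with `t α + 1 ≤ n`, `t β ≤ n`, the slice's ring data inside the cap of `a` and
with PER-BOND ring oscillation `≤ η`: `dist1 (W t·(W (update t α (t α + 1)))⁻¹) ≤ 6·((π−r)∕sin r)·η + 3(π−r)∕n` (T2 (iii) at `λ := 2η`, T0).
[cite: Balaban1985RegularSpaces, Thm 2 p.83] -/
theorem dist1_stageT_step_fst_le (hαβ : α ≠ β) (t : Fin P.d → ℕ) (hα : t α + 1 ≤ n) (hβ : t β ≤ n)
    (hcap : ∀ u : Fin P.d → ℕ, Function.update (Function.update u α (t α)) β (t β) = t → u α ≤ n → u β ≤ n →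
      (u α = 0 ∨ u α = n ∨ u β = 0 ∨ u β = n) → ‖logVec (su2Quat (a⁻¹ * φ u))‖ ≤ π - r)
    {η : ℝ} (hη : 0 ≤ η)
    (hstep : ∀ u : Fin P.d → ℕ, ∀ κ : Fin P.d, (κ = α ∨ κ = β) → Function.update (Function.update u α (t α)) β (t β) = t →
      u α ≤ n → u β ≤ n → (u α = 0 ∨ u α = n ∨ u β = 0 ∨ u β = n) →
      Function.update u κ (u κ + 1) α ≤ n → Function.update u κ (u κ + 1) β ≤ n →
      (Function.update u κ (u κ + 1) α = 0 ∨ Function.update u κ (u κ + 1) α = n ∨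
        Function.update u κ (u κ + 1) β = 0 ∨ Function.update u κ (u κ + 1) β = n) →
      dist1 (φ u * (φ (Function.update u κ (u κ + 1)))⁻¹) ≤ η) :
    dist1 (W t * (W (Function.update t α (t α + 1)))⁻¹) ≤ 6 * ((π - r) / Real.sin r) * η + 3 * (π - r) / n := by
  rw [hW t, hW (Function.update t α (t α + 1)), slice_step_fst φ t α β, Function.update_self, Function.update_of_ne (Ne.symm hαβ)]
  have h := ((hWsq (fun p => φ (Function.update (Function.update t α p.1) β p.2))
    (sliceCap_of_ringCap φ a α β n r hαβ t hcap)).2.2.1 (2 * η) (by positivity)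
    (sliceModulus_of_ringSteps φ α β n hαβ t hη hstep)).1 (t α) (t β) hα hβ
  calc _ ≤ 3 * ((π - r) / Real.sin r) * (2 * η) + 3 * (π - r) / n := h
    _ = 6 * ((π - r) / Real.sin r) * η + 3 * (π - r) / n := by ring

include hW hWsq in
/-- ★★★ **THE IN-SLICE `β`-STEP**: as `dist1_stageT_step_fst_le` with `t α ≤ n`, `t β + 1 ≤ n`: `dist1 (W t·(W (update t β (t β + 1)))⁻¹) ≤ 6·((π−r)∕sin r)·η + 3(π−r)∕n`.
[cite: Balaban1985RegularSpaces, Thm 2 p.83] -/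
theorem dist1_stageT_step_snd_le (hαβ : α ≠ β) (t : Fin P.d → ℕ) (hα : t α ≤ n) (hβ : t β + 1 ≤ n)
    (hcap : ∀ u : Fin P.d → ℕ, Function.update (Function.update u α (t α)) β (t β) = t → u α ≤ n → u β ≤ n →
      (u α = 0 ∨ u α = n ∨ u β = 0 ∨ u β = n) → ‖logVec (su2Quat (a⁻¹ * φ u))‖ ≤ π - r)
    {η : ℝ} (hη : 0 ≤ η)
    (hstep : ∀ u : Fin P.d → ℕ, ∀ κ : Fin P.d, (κ = α ∨ κ = β) → Function.update (Function.update u α (t α)) β (t β) = t →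
      u α ≤ n → u β ≤ n → (u α = 0 ∨ u α = n ∨ u β = 0 ∨ u β = n) →
      Function.update u κ (u κ + 1) α ≤ n → Function.update u κ (u κ + 1) β ≤ n →
      (Function.update u κ (u κ + 1) α = 0 ∨ Function.update u κ (u κ + 1) α = n ∨
        Function.update u κ (u κ + 1) β = 0 ∨ Function.update u κ (u κ + 1) β = n) →
      dist1 (φ u * (φ (Function.update u κ (u κ + 1)))⁻¹) ≤ η) :
    dist1 (W t * (W (Function.update t β (t β + 1)))⁻¹) ≤ 6 * ((π - r) / Real.sin r) * η + 3 * (π - r) / n := by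
  rw [hW t, hW (Function.update t β (t β + 1)), slice_step_snd φ t hαβ, Function.update_self, Function.update_of_ne hαβ]
  have h := ((hWsq (fun p => φ (Function.update (Function.update t α p.1) β p.2))
    (sliceCap_of_ringCap φ a α β n r hαβ t hcap)).2.2.1 (2 * η) (by positivity)
    (sliceModulus_of_ringSteps φ α β n hαβ t hη hstep)).2 (t α) (t β) hα hβ
  calc _ ≤ 3 * ((π - r) / Real.sin r) * (2 * η) + 3 * (π - r) / n := h
    _ = 6 * ((π - r) / Real.sin r) * η + 3 * (π - r) / n := by ring

include hW hWsq in
/-- ★★★ **THE ACROSS-SLICE STEP**: for a direction `γ ∉ {α, β}` and an offset vector `t` with `t α, t β ≤ n`, with the ring data of BOTH slices (`t` and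
`update t γ (t γ + 1)`) inside the cap of `a` and the data's `γ`-bonds through the ring of `t` of oscillation `≤ μ`: `dist1 (W t·(W (update t γ (t γ + 1)))⁻¹) ≤ ((π−r)∕sin r)·μ`
(T2 (iv): same depth, same projection, data `μ`-close there). [cite: Balaban1985RegularSpaces, Thm 2 p.83] -/
theorem dist1_stageT_step_of_ne_le (hαβ : α ≠ β) {γ : Fin P.d} (hγα : γ ≠ α) (hγβ : γ ≠ β) (t : Fin P.d → ℕ) (hα : t α ≤ n) (hβ : t β ≤ n)
    (hcap : ∀ u : Fin P.d → ℕ, Function.update (Function.update u α (t α)) β (t β) = t → u α ≤ n → u β ≤ n →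
      (u α = 0 ∨ u α = n ∨ u β = 0 ∨ u β = n) → ‖logVec (su2Quat (a⁻¹ * φ u))‖ ≤ π - r)
    (hcap' : ∀ u : Fin P.d → ℕ, Function.update (Function.update u α (t α)) β (t β) = Function.update t γ (t γ + 1) → u α ≤ n → u β ≤ n →
      (u α = 0 ∨ u α = n ∨ u β = 0 ∨ u β = n) → ‖logVec (su2Quat (a⁻¹ * φ u))‖ ≤ π - r)
    {μ : ℝ}
    (hclose : ∀ u : Fin P.d → ℕ, Function.update (Function.update u α (t α)) β (t β) = t → u α ≤ n → u β ≤ n →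
      (u α = 0 ∨ u α = n ∨ u β = 0 ∨ u β = n) → dist1 (φ u * (φ (Function.update u γ (u γ + 1)))⁻¹) ≤ μ) :
    dist1 (W t * (W (Function.update t γ (t γ + 1)))⁻¹) ≤ ((π - r) / Real.sin r) * μ := by
  rw [hW t, hW (Function.update t γ (t γ + 1)), Function.update_of_ne (Ne.symm hγα), Function.update_of_ne (Ne.symm hγβ)]
  have hcapψ' : ∀ i k, i ≤ n → k ≤ n → (i = 0 ∨ i = n ∨ k = 0 ∨ k = n) →
      ‖logVec (su2Quat (a⁻¹ * (fun p : ℕ × ℕ => φ (Function.update (Function.update (Function.update t γ (t γ + 1)) α p.1) β p.2)) (i, k)))‖ ≤ π - r := by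
    have hα' : Function.update t γ (t γ + 1) α = t α := Function.update_of_ne (Ne.symm hγα) ..
    have hβ' : Function.update t γ (t γ + 1) β = t β := Function.update_of_ne (Ne.symm hγβ) ..
    have h := sliceCap_of_ringCap φ a α β n r hαβ (Function.update t γ (t γ + 1)) (by rw [hα', hβ']; exact hcap')
    exact h
  refine (hWsq (fun p => φ (Function.update (Function.update t α p.1) β p.2))
    (sliceCap_of_ringCap φ a α β n r hαβ t hcap)).2.2.2
    (fun p : ℕ × ℕ => φ (Function.update (Function.update (Function.update t γ (t γ + 1)) α p.1) β p.2)) μ hcapψ'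
    (fun i k hi hk hb => ?_) (t α) (t β) hα hβ
  have h := hclose (Function.update (Function.update t α i) β k) (uu_mem_slice t hαβ i k)
  rw [uu_apply_fst t hαβ, uu_apply_snd, uu_apply_of_ne t hγα hγβ, uu_step_of_ne t hγα hγβ] at h
  exact h hi hk hb

/-! ## §3 Bond-level laws (sites, bonds, offsets as in (L-I)) -/

variable (s : Fin P.d → ℕ)

include hW hWsq in
/-- ★★★ **THE IN-SLICE BOND STEP**: along a bond `b` in direction `α` or `β` inside the square of its slice (source offsets `t`, target offset `≤ n`, no wrap),
with the slice's ring data inside the cap of `a` and of per-bond oscillation `≤ η`: `dist1 (W (t src)·(W (t tgt))⁻¹) ≤ 6·((π−r)∕sin r)·η + 3(π−r)∕n`.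
[cite: Balaban1985RegularSpaces, Thm 2 p.83] -/
theorem dist1_stageT_inslice_le (hαβ : α ≠ β) (b : PBond P j) (hdir : b.dir = α ∨ b.dir = β)
    (hN : (b.src b.dir - ((s b.dir : ℕ) : ZMod (P.sitesPerDir j))).val + 1 < P.sitesPerDir j)
    (htgtα : Function.update (fun κ => (b.src κ - ((s κ : ℕ) : ZMod (P.sitesPerDir j))).val) b.dir
        ((b.src b.dir - ((s b.dir : ℕ) : ZMod (P.sitesPerDir j))).val + 1) α ≤ n)
    (htgtβ : Function.update (fun κ => (b.src κ - ((s κ : ℕ) : ZMod (P.sitesPerDir j))).val) b.dir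
        ((b.src b.dir - ((s b.dir : ℕ) : ZMod (P.sitesPerDir j))).val + 1) β ≤ n)
    (hcap : ∀ u : Fin P.d → ℕ,
      Function.update (Function.update u α ((b.src α - ((s α : ℕ) : ZMod (P.sitesPerDir j))).val))
          β ((b.src β - ((s β : ℕ) : ZMod (P.sitesPerDir j))).val) = (fun κ => (b.src κ - ((s κ : ℕ) : ZMod (P.sitesPerDir j))).val) →
      u α ≤ n → u β ≤ n → (u α = 0 ∨ u α = n ∨ u β = 0 ∨ u β = n) → ‖logVec (su2Quat (a⁻¹ * φ u))‖ ≤ π - r)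
    {η : ℝ} (hη : 0 ≤ η)
    (hstep : ∀ u : Fin P.d → ℕ, ∀ κ : Fin P.d, (κ = α ∨ κ = β) →
      Function.update (Function.update u α ((b.src α - ((s α : ℕ) : ZMod (P.sitesPerDir j))).val))
          β ((b.src β - ((s β : ℕ) : ZMod (P.sitesPerDir j))).val) = (fun κ => (b.src κ - ((s κ : ℕ) : ZMod (P.sitesPerDir j))).val) →
      u α ≤ n → u β ≤ n → (u α = 0 ∨ u α = n ∨ u β = 0 ∨ u β = n) →
      Function.update u κ (u κ + 1) α ≤ n → Function.update u κ (u κ + 1) β ≤ n →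
      (Function.update u κ (u κ + 1) α = 0 ∨ Function.update u κ (u κ + 1) α = n ∨
        Function.update u κ (u κ + 1) β = 0 ∨ Function.update u κ (u κ + 1) β = n) →
      dist1 (φ u * (φ (Function.update u κ (u κ + 1)))⁻¹) ≤ η) :
    dist1 (W (fun κ => (b.src κ - ((s κ : ℕ) : ZMod (P.sitesPerDir j))).val) *
      (W (fun κ => (b.tgt κ - ((s κ : ℕ) : ZMod (P.sitesPerDir j))).val))⁻¹) ≤ 6 * ((π - r) / Real.sin r) * η + 3 * (π - r) / n := by
  rw [read_tgt_eq W s b hN]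
  set t : Fin P.d → ℕ := fun κ => (b.src κ - ((s κ : ℕ) : ZMod (P.sitesPerDir j))).val with ht
  rcases hdir with hdir | hdir
  · rw [hdir] at htgtα htgtβ ⊢
    rw [Function.update_self] at htgtα
    rw [Function.update_of_ne (Ne.symm hαβ)] at htgtβ
    exact dist1_stageT_step_fst_le φ a α β n r Wsq hWsq W hW hαβ t htgtα htgtβ hcap hη hstep
  · rw [hdir] at htgtα htgtβ ⊢
    rw [Function.update_of_ne hαβ] at htgtα
    rw [Function.update_self] at htgtβ
    exact dist1_stageT_step_snd_le φ a α β n r Wsq hWsq W hW hαβ t htgtα htgtβ hcap hη hstep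

include hW hWsq in
/-- ★★★ **THE TRANSVERSE BOND STEP**: along a bond `b` in a direction `∉ {α, β}` (source offsets `t` with `t α, t β ≤ n`, no wrap), with the ring data of both
slices inside the cap of `a` and the data's `b.dir`-bonds through the ring of oscillation `≤ μ`: `dist1 (W (t src)·(W (t tgt))⁻¹) ≤ ((π−r)∕sin r)·μ`.
[cite: Balaban1985RegularSpaces, Thm 2 p.83] -/
theorem dist1_stageT_transverse_le (hαβ : α ≠ β) (b : PBond P j) (hγα : b.dir ≠ α) (hγβ : b.dir ≠ β)
    (hN : (b.src b.dir - ((s b.dir : ℕ) : ZMod (P.sitesPerDir j))).val + 1 < P.sitesPerDir j)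
    (hα : (b.src α - ((s α : ℕ) : ZMod (P.sitesPerDir j))).val ≤ n) (hβ : (b.src β - ((s β : ℕ) : ZMod (P.sitesPerDir j))).val ≤ n)
    (hcap : ∀ u : Fin P.d → ℕ,
      Function.update (Function.update u α ((b.src α - ((s α : ℕ) : ZMod (P.sitesPerDir j))).val))
          β ((b.src β - ((s β : ℕ) : ZMod (P.sitesPerDir j))).val) = (fun κ => (b.src κ - ((s κ : ℕ) : ZMod (P.sitesPerDir j))).val) →
      u α ≤ n → u β ≤ n → (u α = 0 ∨ u α = n ∨ u β = 0 ∨ u β = n) → ‖logVec (su2Quat (a⁻¹ * φ u))‖ ≤ π - r)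
    (hcap' : ∀ u : Fin P.d → ℕ,
      Function.update (Function.update u α ((b.src α - ((s α : ℕ) : ZMod (P.sitesPerDir j))).val))
          β ((b.src β - ((s β : ℕ) : ZMod (P.sitesPerDir j))).val) =
        Function.update (fun κ => (b.src κ - ((s κ : ℕ) : ZMod (P.sitesPerDir j))).val) b.dir
          ((b.src b.dir - ((s b.dir : ℕ) : ZMod (P.sitesPerDir j))).val + 1) →
      u α ≤ n → u β ≤ n → (u α = 0 ∨ u α = n ∨ u β = 0 ∨ u β = n) → ‖logVec (su2Quat (a⁻¹ * φ u))‖ ≤ π - r)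
    {μ : ℝ}
    (hclose : ∀ u : Fin P.d → ℕ,
      Function.update (Function.update u α ((b.src α - ((s α : ℕ) : ZMod (P.sitesPerDir j))).val))
          β ((b.src β - ((s β : ℕ) : ZMod (P.sitesPerDir j))).val) = (fun κ => (b.src κ - ((s κ : ℕ) : ZMod (P.sitesPerDir j))).val) →
      u α ≤ n → u β ≤ n → (u α = 0 ∨ u α = n ∨ u β = 0 ∨ u β = n) → dist1 (φ u * (φ (Function.update u b.dir (u b.dir + 1)))⁻¹) ≤ μ) :
    dist1 (W (fun κ => (b.src κ - ((s κ : ℕ) : ZMod (P.sitesPerDir j))).val) *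
      (W (fun κ => (b.tgt κ - ((s κ : ℕ) : ZMod (P.sitesPerDir j))).val))⁻¹) ≤ ((π - r) / Real.sin r) * μ := by
  rw [read_tgt_eq W s b hN]
  exact dist1_stageT_step_of_ne_le φ a α β n r Wsq hWsq W hW hαβ hγα hγβ _ hα hβ hcap hcap' hclose

end StageT

end Summit.QuantumFields.YangMills.Theorems.FluctuationComparisonRegPrIntLS2BetaSqrtGaugeStageTBlock

end
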